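import Summits.FinalStateConjecture.FinalStateConjecture.Theorems.EIHFluxBalanceInertialRecessionStubFirstOrderRows

/-!
# Route EIHFluxBalance — `InertialRecession` (E′), skeleton r13, stub `stub_firstOrderSlaving` (D),
# part 10: the own-hole term — applying the momentum coercivity (Bs) to the translated frozen
# background

Helper file for the crux `stmt-FinalStateConjecture-17403` (E′), stub (D). At a late lab time `t`
the frozen background `G_t` translated to the centre event of hole `i`,
`z ↦ G_t(z + (t, ξᵢ(t)))`, is a field of metric components whose `2`-jet at the shell events
`(0, y)` is `η₀`-close to that of `boostedKerrBilin (Λᵢ(t)) 0 Mᵢ aᵢ` (the other frozen summands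
are `C²`-small there), so the quantitative momentum coercivity (Bs) produces a shell offset `y`
at which `c · redᵢ(t)` is bounded by the three momentum rows of the first-order modulated field
`G_t + (x⁰ − t) Vᵢ` at the lab event `(0, y) + (t, ξᵢ(t))` (`firstOrder_rows_translate`).

* `firstOrder_isMetricOn_translate`, `firstOrder_boostedKerrBilin_translate` — bookkeeping;
* `firstOrder_coreA` — the own-term extraction.

Elementary; no definitions, no named facts.
-/

set_option linter.dupNamespace false
set_option maxSynthPendingDepth 6

noncomputable section

open scoped Topology BigOperators
open Filter Set Function Metric Literature.Geometry.Lorentzian Literature.Geometry.Lorentzian.MetricCoord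
  Summit.FinalStateConjecture.FinalStateConjecture.Theorems

namespace Summit.FinalStateConjecture.FinalStateConjecture.Theorems.SublinearIsFree.Slaving

/-! ### Bookkeeping: translations -/

/-- Metric components translated by a constant vector. [folklore] -/
theorem firstOrder_isMetricOn_translate {G : E4 → E4 →L[ℝ] E4 →L[ℝ] ℝ} {W : Set E4}
    (h : MetricCoord.IsMetricOn G W) (c : E4) :
    MetricCoord.IsMetricOn (fun z ↦ G (z + c)) ((fun z ↦ z + c) ⁻¹' W) where
  isOpen := h.isOpen.preimage (continuous_id.add continuous_const)
  contDiffOn := h.contDiffOn.comp (contDiff_id.add contDiff_const).contDiffOn fun _ hz ↦ hz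
  symm := fun _ hz v w ↦ h.symm _ hz v w
  isInvertible := fun _ hz ↦ h.isInvertible _ hz

/-- The painted summand seen from its centre: `boostedKerrBilin L c M a (z + c) = boostedKerrBilin L 0 M a z`.
[folklore] -/
theorem firstOrder_boostedKerrBilin_translate (L : lorentzGroup) (c : E4) (M a : ℝ) (z : E4) :
    boostedKerrBilin L c M a (z + c) = boostedKerrBilin L 0 M a z := by
  have h : poincareInv L c (z + c) = poincareInv L 0 z := by simp [poincareInv]
  ext v w
  rw [boostedKerrBilin_apply, boostedKerrBilin_apply, h]

/-- The rest-frame point seen from the centre: `Λ⁻¹((z + c) − c) = Λ⁻¹(z − 0)`. [folklore] -/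
theorem firstOrder_poincareInv_translate (L : lorentzGroup) (c z : E4) :
    poincareInv L c (z + c) = poincareInv L 0 z := by
  simp [poincareInv]

/-- `C + Σⱼ (fⱼ − C) − fᵢ = Σ_{j ≠ i} (fⱼ − C)` (bookkeeping). [folklore] -/
theorem firstOrder_sum_sub_own {F : Type*} [AddCommGroup F] {N : ℕ} (f : Fin N → F) (C : F)
    (i : Fin N) : C + ∑ j, (f j - C) - f i = ∑ j ∈ Finset.univ.erase i, (f j - C) := by
  rw [← Finset.add_sum_erase _ _ (Finset.mem_univ i)]
  abel

/-- `Σⱼ gⱼ − gᵢ = Σ_{j ≠ i} gⱼ` (bookkeeping). [folklore] -/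
theorem firstOrder_sum_sub_own' {F : Type*} [AddCommGroup F] {N : ℕ} (g : Fin N → F) (i : Fin N) :
    ∑ j, g j - g i = ∑ j ∈ Finset.univ.erase i, g j := by
  rw [← Finset.add_sum_erase _ _ (Finset.mem_univ i)]
  abel

/-- Norm of a sum over the other holes: `‖Σ_{j ≠ i} gⱼ‖ ≤ N δ` if each `‖gⱼ‖ ≤ δ`. [folklore] -/
theorem firstOrder_norm_sum_erase_le {F : Type*} [SeminormedAddCommGroup F] {N : ℕ} (g : Fin N → F)
    (i : Fin N) {δ : ℝ} (hδ : 0 ≤ δ) (h : ∀ j, j ≠ i → ‖g j‖ ≤ δ) :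
    ‖∑ j ∈ Finset.univ.erase i, g j‖ ≤ N * δ := by
  calc ‖∑ j ∈ Finset.univ.erase i, g j‖ ≤ ∑ j ∈ Finset.univ.erase i, ‖g j‖ := norm_sum_le _ _
    _ ≤ ∑ j ∈ Finset.univ.erase i, δ := Finset.sum_le_sum fun j hj ↦ h j (Finset.ne_of_mem_erase hj)
    _ ≤ ∑ _j : Fin N, δ := Finset.sum_le_sum_of_subset_of_nonneg (Finset.erase_subset _ _)
        fun _ _ _ ↦ hδ
    _ = N * δ := by simp

/-! ### Arithmetic of the perturbation estimate -/

/-- Monotonicity of the perturbation bound in the jet sizes. [folklore] -/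
theorem firstOrder_pert_arith {s n₁ n₂ d₀ d₁ d₂ B N δ : ℝ} (hs : 1 ≤ s) (hB : 0 ≤ B) (hN : 0 ≤ N)
    (hn₁ : 0 ≤ n₁) (hn₁' : n₁ ≤ B + 2 * N) (hn₂' : n₂ ≤ B + 2 * N)
    (hd₀ : 0 ≤ d₀) (hd₁ : 0 ≤ d₁) (hd₀' : d₀ ≤ N * δ) (hd₁' : d₁ ≤ N * δ)
    (hd₂' : d₂ ≤ N * δ) :
    s ^ 3 * (5 * n₁ ^ 2 + n₂) * d₀ + 5 * s ^ 2 * n₁ * d₁ + s * d₂ ≤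
      (s ^ 3 * (5 * (B + 2 * N) ^ 2 + (B + 2 * N)) + 5 * s ^ 2 * (B + 2 * N) + s) * (N * δ) := by
  have hs0 : 0 ≤ s := zero_le_one.trans hs
  have h1 : 5 * n₁ ^ 2 + n₂ ≤ 5 * (B + 2 * N) ^ 2 + (B + 2 * N) := by
    nlinarith [mul_le_mul hn₁' hn₁' hn₁ (by linarith)]
  have t1 : s ^ 3 * (5 * n₁ ^ 2 + n₂) * d₀ ≤ s ^ 3 * (5 * (B + 2 * N) ^ 2 + (B + 2 * N)) * (N * δ) :=
    mul_le_mul (mul_le_mul_of_nonneg_left h1 (by positivity)) hd₀' hd₀ (by positivity)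
  have t2 : 5 * s ^ 2 * n₁ * d₁ ≤ 5 * s ^ 2 * (B + 2 * N) * (N * δ) :=
    mul_le_mul (mul_le_mul_of_nonneg_left hn₁' (by positivity)) hd₁' hd₁ (by positivity)
  have t3 : s * d₂ ≤ s * (N * δ) := mul_le_mul_of_nonneg_left hd₂' hs0
  nlinarith

/-- `‖dx⁰‖ ≤ 1` and `‖e_{k+1}‖ = 1` (bookkeeping). [folklore] -/
theorem firstOrder_norm_dx_basis (k : Fin 3) : ‖(E4.dx 0 : E4 →L[ℝ] ℝ)‖ ≤ 1 ∧ ‖(E4.basisVector k.succ : E4)‖ = 1 := by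
  refine ⟨ContinuousLinearMap.opNorm_le_bound _ zero_le_one fun v ↦ ?_, by simp⟩
  rw [one_mul]
  simpa using MinkowskiSimplex.abs_apply_le_norm v 0

/-! ### The own-term extraction -/

section CoreA

variable {N : ℕ} {M a : Fin N → ℝ} {Λ : Fin N → ℝ → lorentzGroup} {ξ : Fin N → ℝ → E3} {γ : ℝ}

-- the algebraic and the operator-norm instance paths on `E4 →L[ℝ] E4 →L[ℝ] ℝ` unify slowly
set_option synthInstance.maxHeartbeats 200000 in
set_option maxHeartbeats 3200000 in
/-- **The own-hole term (applying (Bs) to the translated frozen background).** Fix a hole `i`, a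
lab time `t`, the data `c, ρin, ρout, η₀` of the quantitative momentum coercivity (Bs) of hole `i`,
and assume at time `t`: on the slice ball `{x⁰ = t, ‖x̲ − ξᵢ(t)‖ ≤ ρout}` the other frozen summands
are `C²`-small (`≤ δ`, `N δ ≤ η₀`) and, where `rᵢ ≥ 2Mᵢ`, all frozen radii are positive and the
frozen ansatz is coercive. Then there is a shell offset `y` (`ρin ≤ ‖y‖ ≤ ρout`) with
`c · redᵢ(t) ≤ Σ_k |Ric(G_t + (x⁰−t)Vᵢ)(♯dx⁰, e_{k+1}) − Ric(G_t)(♯dx⁰, e_{k+1})|` at the lab event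
`(0, y) + (t, ξᵢ(t))`, `♯ = ♯_{G_t}`, `Vᵢ` the lab first-variation field of hole `i` at time `t`.
[cite: KerrSchild1965, §3] -/
theorem firstOrder_coreA (hsm : (∀ i, ContDiff ℝ ((⊤ : ℕ∞) : WithTop ℕ∞) (ξ i) ∧ ContDiff ℝ ((⊤ : ℕ∞) : WithTop ℕ∞) (fun t ↦ ((Λ i t : E4 ≃L[ℝ] E4) : E4 →L[ℝ] E4))))
    (i : Fin N) {t c ρin ρout η₀ δ μ : ℝ} (hδ0 : 0 ≤ δ) (hδ : (N : ℝ) * δ ≤ η₀)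
    (hμ : 0 < μ) (hγt : |((Λ i t : E4 ≃L[ℝ] E4) (E4.basisVector 0)) 0| ≤ γ)
    (hrad : (∀ (L : lorentzGroup) (y : E3), |((L : E4 ≃L[ℝ] E4) (E4.basisVector 0)) 0| ≤ γ → ρin ≤ ‖y‖ → 2 * (M i) < Kerr.radius (a i) (poincareInv L 0 (E4.ofTimeSpace 0 y))))
    (hBS : ∀ (L : lorentzGroup) (A : E4 →L[ℝ] E4) (d : E4) (G : E4 → E4 →L[ℝ] E4 →L[ℝ] ℝ) (V : Set E4), |((L : E4 ≃L[ℝ] E4) (E4.basisVector 0)) 0| ≤ γ → (∀ u w : E4, Minkowski.bilin (A u) w + Minkowski.bilin u (A w) = 0) → MetricCoord.IsMetricOn G V → (∀ y : E3, ρin ≤ ‖y‖ → ‖y‖ ≤ ρout → (E4.ofTimeSpace 0 y) ∈ V ∧ ‖G (E4.ofTimeSpace 0 y) - boostedKerrBilin L 0 (M i) (a i) (E4.ofTimeSpace 0 y)‖ ≤ η₀ ∧ ‖fderiv ℝ G (E4.ofTimeSpace 0 y) - fderiv ℝ (boostedKerrBilin L 0 (M i) (a i)) (E4.ofTimeSpace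 0 y)‖ ≤ η₀ ∧ ‖fderiv ℝ (fderiv ℝ G) (E4.ofTimeSpace 0 y) - fderiv ℝ (fderiv ℝ (boostedKerrBilin L 0 (M i) (a i))) (E4.ofTimeSpace 0 y)‖ ≤ η₀) → ∃ y : E3, ρin ≤ ‖y‖ ∧ ‖y‖ ≤ ρout ∧ c * (‖A (E4.basisVector 0)‖ + ‖E4.spatial d‖ + ‖(a i) • A (E4.basisVector 3)‖) ≤ ∑ j : Fin 3, |MetricCoord.ricAt (fun z : E4 ↦ G z + (z 0) • ((fderiv ℝ (Kerr.bilin (M i) (a i)) (poincareInv L 0 z) (A (poincareInv L 0 z) + d)).bilinearComp (((L : E4 ≃L[ℝ] E4).symm : E4 →L[ℝ] E4)) (((L : E4 ≃L[ℝ] E4).symm : E4 →L[ℝ] E4)) + (Kerr.bilin (M i) (a i) (poincareInv L 0 z)).bilinearComp (A.comp (((L : E4 ≃L[ℝ] E4).symm : E4 →L[ℝ] E4))) (((L : E4 ≃L[ℝ] E4).symm : E4 →L[ℝ] E4)) + (Kerr.bilin (M i) (a i) (poincareInv L 0 z)).bilinearComp (((L : E4 ≃L[ℝ] E4).symm : E4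 →L[ℝ] E4)) (A.comp (((L : E4 ≃L[ℝ] E4).symm : E4 →L[ℝ] E4))))) (E4.ofTimeSpace 0 y) (MetricCoord.sharpAt G (E4.ofTimeSpace 0 y) (E4.dx 0)) (E4.basisVector j.succ) - MetricCoord.ricAt G (E4.ofTimeSpace 0 y) (MetricCoord.sharpAt G (E4.ofTimeSpace 0 y) (E4.dx 0)) (E4.basisVector j.succ)|)
    (hfz : ∀ x : E4, x 0 = t → ‖E4.spatial x - ξ i t‖ ≤ ρout → ∀ j, j ≠ i → ∀ k ≤ 2,
      ‖iteratedFDeriv ℝ k (fun z : E4 ↦ boostedKerrBilin (Λ j t) (E4.ofTimeSpace t (ξ j t)) (M j) (a j) z - Minkowski.bilin) x‖ ≤ δ)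
    (hco : ∀ x : E4, x 0 = t → ‖E4.spatial x - ξ i t‖ ≤ ρout →
      2 * M i ≤ Kerr.radius (a i) (poincareInv (Λ i t) (E4.ofTimeSpace t (ξ i t)) x) →
      (∀ j, 0 < Kerr.radius (a j) (poincareInv (Λ j t) (E4.ofTimeSpace t (ξ j t)) x)) ∧
      ∀ v : E4, μ * ‖v‖ ≤ ‖(fun z : E4 ↦ Minkowski.bilin + ∑ j, (boostedKerrBilin (Λ j t) (E4.ofTimeSpace t (ξ j t)) (M j) (a j) z - Minkowski.bilin)) x v‖) :
    ∃ y : E3, ρin ≤ ‖y‖ ∧ ‖y‖ ≤ ρout ∧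
      c * (‖((deriv (fun s ↦ (((Λ i s : E4 ≃L[ℝ] E4).symm : E4 →L[ℝ] E4))) t).comp ((Λ i t : E4 ≃L[ℝ] E4) : E4 →L[ℝ] E4)) (E4.basisVector 0)‖ + ‖E4.spatial (-((((Λ i t : E4 ≃L[ℝ] E4).symm : E4 →L[ℝ] E4)) (deriv (fun s ↦ E4.ofTimeSpace s (ξ i s)) t)))‖ + ‖(a i) • ((deriv (fun s ↦ (((Λ i s : E4 ≃L[ℝ] E4).symm : E4 →L[ℝ] E4))) t).comp ((Λ i t : E4 ≃L[ℝ] E4) : E4 →L[ℝ] E4)) (E4.basisVector 3)‖) ≤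
      ∑ k : Fin 3, |MetricCoord.ricAt (fun z : E4 ↦ (fun z : E4 ↦ Minkowski.bilin + ∑ j, (boostedKerrBilin (Λ j t) (E4.ofTimeSpace t (ξ j t)) (M j) (a j) z - Minkowski.bilin)) z + ((E4.dx 0) z - t) • ((fderiv ℝ (Kerr.bilin (M i) (a i)) (poincareInv (Λ i t) (E4.ofTimeSpace t (ξ i t)) z) (((deriv (fun s ↦ (((Λ i s : E4 ≃L[ℝ] E4).symm : E4 →L[ℝ] E4))) t).comp ((Λ i t : E4 ≃L[ℝ] E4) : E4 →L[ℝ] E4)) (poincareInv (Λ i t) (E4.ofTimeSpace t (ξ i t)) z) + (-((((Λ i t : E4 ≃L[ℝ] E4).symm : E4 →L[ℝ] E4)) (deriv (fun s ↦ E4.ofTimeSpace s (ξ i s)) t))))).bilinearComp (((Λ i t : E4 ≃L[ℝ] E4).symm : E4 →L[ℝ] E4)) (((Λ i t : E4 ≃L[ℝ] E4).symm : E4 →L[ℝ] E4)) + ((Kerr.bilin (M i) (a i)) (poincareInv (Λ i t) (E4.ofTimeSpace t (ξ i t)) z)).bilinearComp (((deriv (fun s ↦ (((Λ i s : E4 ≃L[ℝ]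 E4).symm : E4 →L[ℝ] E4))) t).comp ((Λ i t : E4 ≃L[ℝ] E4) : E4 →L[ℝ] E4)).comp (((Λ i t : E4 ≃L[ℝ] E4).symm : E4 →L[ℝ] E4))) (((Λ i t : E4 ≃L[ℝ] E4).symm : E4 →L[ℝ] E4)) + ((Kerr.bilin (M i) (a i)) (poincareInv (Λ i t) (E4.ofTimeSpace t (ξ i t)) z)).bilinearComp (((Λ i t : E4 ≃L[ℝ] E4).symm : E4 →L[ℝ] E4)) (((deriv (fun s ↦ (((Λ i s : E4 ≃L[ℝ] E4).symm : E4 →L[ℝ] E4))) t).comp ((Λ i t : E4 ≃L[ℝ] E4) : E4 →L[ℝ] E4)).comp (((Λ i t : E4 ≃L[ℝ] E4).symm : E4 →L[ℝ] E4))))) (E4.ofTimeSpace 0 y + (E4.ofTimeSpace t (ξ i t))) (MetricCoord.sharpAt (fun z : E4 ↦ Minkowski.bilin + ∑ j, (boostedKerrBilin (Λ j t) (E4.ofTimeSpace t (ξ j t)) (M j) (a j) z - Minkowski.bilin)) (E4.ofTimeSpace 0 y + (E4.ofTimeSpace t (ξ i t))) (E4.dx 0)) (E4.basisVector k.succ)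 - MetricCoord.ricAt (fun z : E4 ↦ Minkowski.bilin + ∑ j, (boostedKerrBilin (Λ j t) (E4.ofTimeSpace t (ξ j t)) (M j) (a j) z - Minkowski.bilin)) (E4.ofTimeSpace 0 y + (E4.ofTimeSpace t (ξ i t))) (MetricCoord.sharpAt (fun z : E4 ↦ Minkowski.bilin + ∑ j, (boostedKerrBilin (Λ j t) (E4.ofTimeSpace t (ξ j t)) (M j) (a j) z - Minkowski.bilin)) (E4.ofTimeSpace 0 y + (E4.ofTimeSpace t (ξ i t))) (E4.dx 0)) (E4.basisVector k.succ)| := by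
  classical
  set Gt : E4 → E4 →L[ℝ] E4 →L[ℝ] ℝ := (fun z : E4 ↦ Minkowski.bilin + ∑ j, (boostedKerrBilin (Λ j t) (E4.ofTimeSpace t (ξ j t)) (M j) (a j) z - Minkowski.bilin)) with hGt
  set ci : E4 := (E4.ofTimeSpace t (ξ i t)) with hci
  have hci0 : ci 0 = t := by simp [hci]
  set Ai : E4 →L[ℝ] E4 := ((deriv (fun s ↦ (((Λ i s : E4 ≃L[ℝ] E4).symm : E4 →L[ℝ] E4))) t).comp ((Λ i t : E4 ≃L[ℝ] E4) : E4 →L[ℝ] E4)) with hAi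
  set di : E4 := (-((((Λ i t : E4 ≃L[ℝ] E4).symm : E4 →L[ℝ] E4)) (deriv (fun s ↦ E4.ofTimeSpace s (ξ i s)) t))) with hdi
  -- the lab and the centred variation fields of hole `i`
  set Vl : E4 → E4 →L[ℝ] E4 →L[ℝ] ℝ := fun z ↦ (fderiv ℝ (Kerr.bilin (M i) (a i)) (poincareInv (Λ i t) (E4.ofTimeSpace t (ξ i t)) z) (((deriv (fun s ↦ (((Λ i s : E4 ≃L[ℝ] E4).symm : E4 →L[ℝ] E4))) t).comp ((Λ i t : E4 ≃L[ℝ] E4) : E4 →L[ℝ] E4)) (poincareInv (Λ i t) (E4.ofTimeSpace t (ξ i t)) z) + (-((((Λ i t : E4 ≃L[ℝ] E4).symm : E4 →L[ℝ] E4)) (deriv (fun s ↦ E4.ofTimeSpace s (ξ i s)) t))))).bilinearComp (((Λ i t : E4 ≃L[ℝ] E4).symm : E4 →L[ℝ] E4)) (((Λ i t : E4 ≃L[ℝ] E4).symm : E4 →L[ℝ] E4)) + ((Kerr.bilin (M i) (a i)) (poincareInv (Λ i t) (E4.ofTimeSpace t (ξ i t)) z)).bilinearComp (((deriv (fun s ↦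 (((Λ i s : E4 ≃L[ℝ] E4).symm : E4 →L[ℝ] E4))) t).comp ((Λ i t : E4 ≃L[ℝ] E4) : E4 →L[ℝ] E4)).comp (((Λ i t : E4 ≃L[ℝ] E4).symm : E4 →L[ℝ] E4))) (((Λ i t : E4 ≃L[ℝ] E4).symm : E4 →L[ℝ] E4)) + ((Kerr.bilin (M i) (a i)) (poincareInv (Λ i t) (E4.ofTimeSpace t (ξ i t)) z)).bilinearComp (((Λ i t : E4 ≃L[ℝ] E4).symm : E4 →L[ℝ] E4)) (((deriv (fun s ↦ (((Λ i s : E4 ≃L[ℝ] E4).symm : E4 →L[ℝ] E4))) t).comp ((Λ i t : E4 ≃L[ℝ] E4) : E4 →L[ℝ] E4)).comp (((Λ i t : E4 ≃L[ℝ] E4).symm : E4 →L[ℝ] E4))) with hVl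
  set Vc : E4 → E4 →L[ℝ] E4 →L[ℝ] ℝ := fun z ↦ (fderiv ℝ (Kerr.bilin (M i) (a i)) (poincareInv (Λ i t) 0 z) (((deriv (fun s ↦ (((Λ i s : E4 ≃L[ℝ] E4).symm : E4 →L[ℝ] E4))) t).comp ((Λ i t : E4 ≃L[ℝ] E4) : E4 →L[ℝ] E4)) (poincareInv (Λ i t) 0 z) + (-((((Λ i t : E4 ≃L[ℝ] E4).symm : E4 →L[ℝ] E4)) (deriv (fun s ↦ E4.ofTimeSpace s (ξ i s)) t))))).bilinearComp (((Λ i t : E4 ≃L[ℝ] E4).symm : E4 →L[ℝ] E4)) (((Λ i t : E4 ≃L[ℝ] E4).symm : E4 →L[ℝ] E4)) + ((Kerr.bilin (M i) (a i)) (poincareInv (Λ i t) 0 z)).bilinearComp (((deriv (fun s ↦ (((Λ i s : E4 ≃L[ℝ] E4).symm : E4 →L[ℝ] E4))) t).comp ((Λ i t : E4 ≃L[ℝ] E4) : E4 →L[ℝ] E4)).comp (((Λ i t : E4 ≃L[ℝ] E4).symm : E4 →L[ℝ] E4))) (((Λ i t : E4 ≃L[ℝ] E4).symm : E4 →L[ℝ]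 E4)) + ((Kerr.bilin (M i) (a i)) (poincareInv (Λ i t) 0 z)).bilinearComp (((Λ i t : E4 ≃L[ℝ] E4).symm : E4 →L[ℝ] E4)) (((deriv (fun s ↦ (((Λ i s : E4 ≃L[ℝ] E4).symm : E4 →L[ℝ] E4))) t).comp ((Λ i t : E4 ≃L[ℝ] E4) : E4 →L[ℝ] E4)).comp (((Λ i t : E4 ≃L[ℝ] E4).symm : E4 →L[ℝ] E4))) with hVc
  have hVV : ∀ z, Vl (z + ci) = Vc z := by
    intro z
    simp only [hVl, hVc, hci, firstOrder_poincareInv_translate]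
  -- skewness of the body rate
  have hSd : HasDerivAt (fun s ↦ (((Λ i s : E4 ≃L[ℝ] E4).symm : E4 →L[ℝ] E4)))
      (deriv (fun s ↦ (((Λ i s : E4 ≃L[ℝ] E4).symm : E4 →L[ℝ] E4))) t) t :=
    ((contDiff_lorentz_symm (hsm i).2).differentiable (by simp) t).hasDerivAt
  have hA : ∀ u w : E4, Minkowski.bilin (Ai u) w + Minkowski.bilin u (Ai w) = 0 :=
    fun u w ↦ minkowski_skew_of_hasDerivAt_lorentz_symm hSd u w
  -- the frozen background as a field of metric components
  set U : Set E4 := {z : E4 | ∀ j, 0 < Kerr.radius (a j) (poincareInv (Λ j t) (E4.ofTimeSpace t (ξ j t)) z)}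
    with hU
  have hUo : IsOpen U := firstOrder_isOpen_frozenDomain a Λ ξ t
  have hGsm : ∀ z ∈ U, ContDiffAt ℝ ((⊤ : ℕ∞) : WithTop ℕ∞) Gt z := fun z hz ↦
    firstOrder_contDiffAt_frozen M hz
  have hGsy : ∀ z v w, Gt z v w = Gt z w v := fun z v w ↦ firstOrder_frozen_symm M a Λ ξ t z v w
  have hmet : MetricCoord.IsMetricOn Gt (U ∩ {z | (Gt z).IsInvertible}) := firstOrder_isMetricOn_of hUo hGsm hGsy
  have hmet' := firstOrder_isMetricOn_translate hmet ci
  -- shell events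
  have hshell : ∀ y : E3, ρin ≤ ‖y‖ → ‖y‖ ≤ ρout →
      (E4.ofTimeSpace 0 y + ci) 0 = t ∧ ‖E4.spatial (E4.ofTimeSpace 0 y + ci) - ξ i t‖ = ‖y‖ ∧
      poincareInv (Λ i t) ci (E4.ofTimeSpace 0 y + ci) = poincareInv (Λ i t) 0 (E4.ofTimeSpace 0 y) ∧
      2 * M i < Kerr.radius (a i) (poincareInv (Λ i t) ci (E4.ofTimeSpace 0 y + ci)) := by
    intro y hy1 _
    have h3 : poincareInv (Λ i t) ci (E4.ofTimeSpace 0 y + ci) = poincareInv (Λ i t) 0 (E4.ofTimeSpace 0 y) :=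
      firstOrder_poincareInv_translate _ _ _
    refine ⟨by simp [hci], ?_, h3, ?_⟩
    · congr 1
      simp [hci]
    · rw [h3]; exact hrad (Λ i t) y hγt hy1
  -- jets of the frozen background at shell events
  have hjets : ∀ y : E3, ρin ≤ ‖y‖ → ‖y‖ ≤ ρout →
      (E4.ofTimeSpace 0 y) ∈ (fun z ↦ z + ci) ⁻¹' (U ∩ {z | (Gt z).IsInvertible}) ∧
      ‖(fun z ↦ Gt (z + ci)) (E4.ofTimeSpace 0 y) - boostedKerrBilin (Λ i t) 0 (M i) (a i) (E4.ofTimeSpace 0 y)‖ ≤ η₀ ∧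
      ‖fderiv ℝ (fun z ↦ Gt (z + ci)) (E4.ofTimeSpace 0 y) -
        fderiv ℝ (boostedKerrBilin (Λ i t) 0 (M i) (a i)) (E4.ofTimeSpace 0 y)‖ ≤ η₀ ∧
      ‖fderiv ℝ (fderiv ℝ (fun z ↦ Gt (z + ci))) (E4.ofTimeSpace 0 y) -
        fderiv ℝ (fderiv ℝ (boostedKerrBilin (Λ i t) 0 (M i) (a i))) (E4.ofTimeSpace 0 y)‖ ≤ η₀ := by
    intro y hy1 hy2
    obtain ⟨hx0, hxs, hpI, hri⟩ := hshell y hy1 hy2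
    set x : E4 := E4.ofTimeSpace 0 y + ci with hx
    obtain ⟨hradii, hcoer⟩ := hco x hx0 (by rw [hxs]; exact hy2) hri.le
    have hinv : (Gt x).IsInvertible := firstOrder_isInvertible_of_coercive hμ hcoer
    refine ⟨⟨hradii, hinv⟩, ?_, ?_, ?_⟩
    -- the own summand seen from its centre
    · have hK : boostedKerrBilin (Λ i t) 0 (M i) (a i) (E4.ofTimeSpace 0 y) =
          boostedKerrBilin (Λ i t) ci (M i) (a i) x := (firstOrder_boostedKerrBilin_translate _ _ _ _ _).symm
      rw [hK]
      show ‖Gt x - boostedKerrBilin (Λ i t) ci (M i) (a i) x‖ ≤ η₀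
      have hval : Gt x - boostedKerrBilin (Λ i t) ci (M i) (a i) x =
          ∑ j ∈ Finset.univ.erase i, (boostedKerrBilin (Λ j t) (E4.ofTimeSpace t (ξ j t)) (M j) (a j) x -
            Minkowski.bilin) := by
        simp only [hGt, hci]
        exact firstOrder_sum_sub_own
          (fun j ↦ boostedKerrBilin (Λ j t) (E4.ofTimeSpace t (ξ j t)) (M j) (a j) x) Minkowski.bilin i
      rw [hval]
      refine (firstOrder_norm_sum_erase_le (fun j ↦ boostedKerrBilin (Λ j t) (E4.ofTimeSpace t (ξ j t))
        (M j) (a j) x - Minkowski.bilin) i hδ0 fun j hj ↦ ?_).trans hδ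
      have := hfz x hx0 (by rw [hxs]; exact hy2) j hj 0 (by norm_num)
      rwa [norm_iteratedFDeriv_zero] at this
    · have hK : boostedKerrBilin (Λ i t) 0 (M i) (a i) =
          fun z ↦ boostedKerrBilin (Λ i t) ci (M i) (a i) (z + ci) :=
        funext fun _ ↦ (firstOrder_boostedKerrBilin_translate _ _ _ _ _).symm
      rw [hK, fderiv_comp_add_right, fderiv_comp_add_right]
      have h2 : ∀ j ∈ (Finset.univ : Finset (Fin N)), ContDiffAt ℝ 2
          (fun z : E4 ↦ boostedKerrBilin (Λ j t) (E4.ofTimeSpace t (ξ j t)) (M j) (a j) z) x := fun j _ ↦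
        contDiffAt_boostedKerrBilin (Λ j t) _ (M j) (a j) (hradii j)
      obtain ⟨hs1, -⟩ := firstOrder_jets_const_add_sum Finset.univ (Minkowski.bilin : E4 →L[ℝ] E4 →L[ℝ] ℝ) h2
      have hval : fderiv ℝ Gt x - fderiv ℝ (boostedKerrBilin (Λ i t) ci (M i) (a i)) x =
          ∑ j ∈ Finset.univ.erase i, fderiv ℝ (fun z : E4 ↦
            boostedKerrBilin (Λ j t) (E4.ofTimeSpace t (ξ j t)) (M j) (a j) z - Minkowski.bilin) x := by
        rw [hGt, hs1]
        simp only [fderiv_sub_const]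
        exact firstOrder_sum_sub_own'
          (fun j ↦ fderiv ℝ (fun z : E4 ↦ boostedKerrBilin (Λ j t) (E4.ofTimeSpace t (ξ j t)) (M j) (a j) z) x) i
      show ‖fderiv ℝ Gt x - fderiv ℝ (boostedKerrBilin (Λ i t) ci (M i) (a i)) x‖ ≤ η₀
      rw [hval]
      refine (firstOrder_norm_sum_erase_le (fun j ↦ fderiv ℝ (fun z : E4 ↦
        boostedKerrBilin (Λ j t) (E4.ofTimeSpace t (ξ j t)) (M j) (a j) z - Minkowski.bilin) x)
        i hδ0 fun j hj ↦ ?_).trans hδ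
      have := hfz x hx0 (by rw [hxs]; exact hy2) j hj 1 (by norm_num)
      rwa [← (norm_fderiv_eq_norm_iteratedFDeriv _ x).1] at this
    · have hK : boostedKerrBilin (Λ i t) 0 (M i) (a i) =
          fun z ↦ boostedKerrBilin (Λ i t) ci (M i) (a i) (z + ci) :=
        funext fun _ ↦ (firstOrder_boostedKerrBilin_translate _ _ _ _ _).symm
      have hD1 : fderiv ℝ (fun z ↦ Gt (z + ci)) = fun z ↦ fderiv ℝ Gt (z + ci) :=
        funext fun z ↦ by rw [fderiv_comp_add_right]
      have hD1' : fderiv ℝ (fun z ↦ boostedKerrBilin (Λ i t) ci (M i) (a i) (z + ci)) =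
          fun z ↦ fderiv ℝ (boostedKerrBilin (Λ i t) ci (M i) (a i)) (z + ci) :=
        funext fun z ↦ by rw [fderiv_comp_add_right]
      rw [hK, hD1, hD1', fderiv_comp_add_right, fderiv_comp_add_right]
      have h2 : ∀ j ∈ (Finset.univ : Finset (Fin N)), ContDiffAt ℝ 2
          (fun z : E4 ↦ boostedKerrBilin (Λ j t) (E4.ofTimeSpace t (ξ j t)) (M j) (a j) z) x := fun j _ ↦
        contDiffAt_boostedKerrBilin (Λ j t) _ (M j) (a j) (hradii j)
      obtain ⟨-, hs2⟩ := firstOrder_jets_const_add_sum Finset.univ (Minkowski.bilin : E4 →L[ℝ] E4 →L[ℝ] ℝ) h2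
      have hval : fderiv ℝ (fderiv ℝ Gt) x - fderiv ℝ (fderiv ℝ (boostedKerrBilin (Λ i t) ci (M i) (a i))) x =
          ∑ j ∈ Finset.univ.erase i, fderiv ℝ (fderiv ℝ (fun z : E4 ↦
            boostedKerrBilin (Λ j t) (E4.ofTimeSpace t (ξ j t)) (M j) (a j) z - Minkowski.bilin)) x := by
        have e1 : fderiv ℝ (fderiv ℝ Gt) x = ∑ j, fderiv ℝ (fderiv ℝ (fun z : E4 ↦
            boostedKerrBilin (Λ j t) (E4.ofTimeSpace t (ξ j t)) (M j) (a j) z)) x := by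
          refine ContinuousLinearMap.ext fun v ↦ ?_
          rw [sum_apply]
          exact hs2 v
        have e2 : ∀ j, fderiv ℝ (fun z : E4 ↦ boostedKerrBilin (Λ j t) (E4.ofTimeSpace t (ξ j t)) (M j) (a j) z -
            Minkowski.bilin) = fderiv ℝ (fun z : E4 ↦
              boostedKerrBilin (Λ j t) (E4.ofTimeSpace t (ξ j t)) (M j) (a j) z) := fun j ↦
          funext fun _ ↦ fderiv_sub_const _
        rw [e1]
        simp only [e2]
        exact firstOrder_sum_sub_own' (fun j ↦ fderiv ℝ (fderiv ℝ (fun z : E4 ↦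
          boostedKerrBilin (Λ j t) (E4.ofTimeSpace t (ξ j t)) (M j) (a j) z)) x) i
      show ‖fderiv ℝ (fderiv ℝ Gt) x - fderiv ℝ (fderiv ℝ (boostedKerrBilin (Λ i t) ci (M i) (a i))) x‖ ≤ η₀
      rw [hval]
      refine (firstOrder_norm_sum_erase_le (fun j ↦ fderiv ℝ (fderiv ℝ (fun z : E4 ↦
        boostedKerrBilin (Λ j t) (E4.ofTimeSpace t (ξ j t)) (M j) (a j) z - Minkowski.bilin)) x)
        i hδ0 fun j hj ↦ ?_).trans hδ
      have := hfz x hx0 (by rw [hxs]; exact hy2) j hj 2 le_rfl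
      rwa [← (norm_fderiv_eq_norm_iteratedFDeriv _ x).2] at this
  -- apply (Bs)
  obtain ⟨y, hy1, hy2, hineq⟩ := hBS (Λ i t) Ai di (fun z ↦ Gt (z + ci))
    ((fun z ↦ z + ci) ⁻¹' (U ∩ {z | (Gt z).IsInvertible})) hγt hA hmet' hjets
  refine ⟨y, hy1, hy2, hineq.trans (le_of_eq ?_)⟩
  -- translate the rows back to the lab
  refine Finset.sum_congr rfl fun k _ ↦ ?_
  rw [firstOrder_rows_translate Gt Vl Vc hci0 hVV (E4.ofTimeSpace 0 y) (E4.basisVector k.succ)]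

end CoreA

/-- **Registered one-line carrier form** (`firstOrder_translate_D10`, stub (D) of the crux item) of
`firstOrder_boostedKerrBilin_translate`. [folklore] -/
theorem firstOrder_translate_D10 : open Literature.Geometry.Lorentzian in ∀ (L : lorentzGroup) (c : E4) (M a : ℝ) (z : E4), boostedKerrBilin L c M a (z + c) = boostedKerrBilin L 0 M a z :=
  firstOrder_boostedKerrBilin_translate

end Summit.FinalStateConjecture.FinalStateConjecture.Theorems.SublinearIsFree.Slaving

end
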